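import Summits.ABC.IUTFork.Thm311RealInd1Strip
import Summits.ABC.IUTFork.Thm311RealInd2IsmRigid
import HarnessLib

/-!
# [IUTchIII] Theorem 3.11 (i) (Ind1), print-literal at `v ∈ 𝕍^non`: WHICH SUB-LATTICES a strip automorphism fixes —
# reduction to THE units transport `Real.liftUnits v φ` on `𝒪_v^×`

Proof-only record file (D-0012) of the abc-iut cell (seat abc-iut-c312-1, holder of record of the typed [IUTchIII] Thm.
3.11, gen 8); sequel of `Thm311RealInd1Strip.lean`.  TAKES NO SIDE on [IUTchIII] Cor. 3.12.

THE QUESTION IT ISOLATES.  Gen 7 proved that print's (Ind2) at a finite place FIXES every sub-lattice `M` of the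
log-lattice `Λ_v = L(𝒪_v^×)` whose unit preimage is open (`Real.image_eq_of_realises_of_le_range`: `G_v`-isometries permute
norm classes; LCFT) — no (Ind2)-driven hull inflation under print's reading.  For print's (Ind1) STRIP PART the same
question — does a realised strip automorphism `ψ` (realising `φ ∈ Aut_top(G_v)` through `L`) fix, say, the log-image of a
higher unit group `U_v^{(m)}` (an `𝒪_v`-ideal-shaped region of the log-shell, the shape of the Θ-pilot regions)? — is
EQUIVALENT to a property of THE units transport `β = Real.liftUnits v φ` of `φ` on `𝒪_v^×` ([AbsAnab] Prop. 1.2.1 (iii)/(vi):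
`β = Art⁻¹ ∘ φ^{ab} ∘ Art` on `K_v^×`): `ψ` maps `M` into `M` iff `β` maps the unit preimage `{u : L u ∈ M}` into itself
(`Real.image_subset_iff_liftUnits_mapsTo`), and `ψ(M) = M` iff `β` AND `β⁻¹` do (`Real.image_eq_iff_liftUnits_mapsTo`).
What the tree PROVES about `β`: norm-rigid (`Thm311RealInd1StripRigid`), `= 1` at local degree one (`…DegOne`), `= γ` for
the strip automorphism of a valuation-preserving field automorphism `γ` (`…NonVacuity`), `= 1` for inner `φ`
(`Real.liftUnits_innerAut`) — in all these cases every `L`-saturated `𝒪_v^×`-stable `M` is fixed (§3).  What the tree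
does NOT decide (and [AbsAnab] Prop. 1.2.1 (i)–(vii) does not list): whether THE units transport of an ARBITRARY
(non-geometric) `φ ∈ Aut_top(G_v)` preserves the higher unit groups `μ·U_v^{(m)}` — equivalently whether `φ^{ab}`
preserves the images of the upper ramification filtration in `G_v^{ab}` (S. Mochizuki, *A version of the Grothendieck
conjecture for p-adic local fields*, Int. J. Math. 8 (1997): filtration-preserving ⇔ geometric, for the filtration on the
FULL group).  A `φ` moving some `μ·U_v^{(m)}` would be an (Ind1)-MOVER UNDER PRINT'S READING (the analogue of the
Dupuy–Hilado (Ind2)-movers of record); its absence would make print's finite-place (Ind1)+(Ind2) fix every ideal-shaped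
sub-lattice.  This file records the reduction only; no side taken.

PROVED (ns `Summit.ABC.IUTFork.Thm311.Real`): `realises_strip_symm`, `image_log_image_eq_of_realises_strip`,
`image_subset_iff_liftUnits_mapsTo`, `image_eq_iff_liftUnits_mapsTo`, `image_eq_of_liftUnits_map_eq`,
`image_eq_of_realises_innerAut` (inner `φ`: every `M ⊆ range L` fixed).
[claim: Mochizuki2012, status: disputed] for the quotations; [cite: MochizukiAbsAnab2004, Prop 1.2.1 (iii) p.10].
typed ≠ proved elsewhere; instantiated ≠ endorsed.
-/

set_option autoImplicit false

noncomputable section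

namespace Summit.ABC.IUTFork.Thm311.Real

open NumberField IsDedekindDomain Literature.IUT.LogVolume Literature.IUT.LogThetaLattice
open Literature.AnabelianGeometry.AbsoluteAnabelian Literature.IUT.HodgeArakelov
open Literature.IUT.HodgeArakelov.AbsTopMonoids

variable {F : Type} [Field F] [NumberField F] (v : HeightOneSpectrum (𝓞 F))
  (L : Additive (↥(v.adicCompletionIntegers F))ˣ →+ v.adicCompletion F)

/-! ## 1. Inverses and images of unit sets -/

/-- `(liftUnits v φ)⁻¹ = liftUnits v φ⁻¹` pointwise. [folklore] -/
theorem liftUnits_symm_apply (φ : Gal v ≃ₜ* Gal v) (u : (↥(v.adicCompletionIntegers F))ˣ) :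
    (liftUnits v φ).symm u = liftUnits v φ.symm u := rfl

/-- If `ψ` realises the strip automorphism `φ` through `L`, then `ψ⁻¹` realises `φ⁻¹`. [claim: Mochizuki2012, status: disputed] -/
theorem realises_strip_symm {φ : Gal v ≃ₜ* Gal v} {ψ : v.adicCompletion F ≃+ v.adicCompletion F}
    (hψ : Realises v L (stripMulAut v φ) ψ) : Realises v L (stripMulAut v φ.symm) ψ.symm := by
  rw [realises_stripMulAut_iff] at hψ ⊢
  intro u
  apply ψ.injective
  rw [AddEquiv.apply_symm_apply, hψ, ← liftUnits_symm_apply, MulEquiv.apply_symm_apply]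

/-- **A realised strip automorphism carries `L(S)` to `L(β(S))`**, `β = liftUnits v φ`, for every set of units `S`.
[claim: Mochizuki2012, status: disputed] -/
theorem image_log_image_eq_of_realises_strip {φ : Gal v ≃ₜ* Gal v} {ψ : v.adicCompletion F ≃+ v.adicCompletion F}
    (hψ : Realises v L (stripMulAut v φ) ψ) (S : Set (↥(v.adicCompletionIntegers F))ˣ) :
    ψ '' ((fun u => L (Additive.ofMul u)) '' S) = (fun u => L (Additive.ofMul u)) '' (liftUnits v φ '' S) := by
  rw [realises_stripMulAut_iff] at hψ
  apply Set.Subset.antisymm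
  · rintro _ ⟨_, ⟨u, hu, rfl⟩, rfl⟩
    exact ⟨liftUnits v φ u, ⟨u, hu, rfl⟩, (hψ u).symm⟩
  · rintro _ ⟨_, ⟨u, hu, rfl⟩, rfl⟩
    exact ⟨L (Additive.ofMul u), ⟨u, hu, rfl⟩, hψ u⟩

/-! ## 2. The criterion: `ψ` fixes a sub-lattice iff THE units transport fixes its unit preimage -/

section Criterion

variable {φ : Gal v ≃ₜ* Gal v} {ψ : v.adicCompletion F ≃+ v.adicCompletion F}

/-- **`ψ(M) ⊆ M` iff `β` maps `{u : L u ∈ M}` into itself** (`β = liftUnits v φ`), for every additive subgroup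
`M ⊆ L(𝒪_v^×)` and every `ψ` realising `φ` through `L`. [cite: MochizukiAbsAnab2004, Prop 1.2.1 (iii) p.10] -/
theorem image_subset_iff_liftUnits_mapsTo (hψ : Realises v L (stripMulAut v φ) ψ) (M : AddSubgroup (v.adicCompletion F))
    (hM : (M : Set (v.adicCompletion F)) ⊆ Set.range fun u : (↥(v.adicCompletionIntegers F))ˣ => L (Additive.ofMul u)) :
    ψ '' (M : Set (v.adicCompletion F)) ⊆ M ↔
      ∀ u ∈ unitPreimage L M, liftUnits v φ u ∈ unitPreimage L M := by
  rw [realises_stripMulAut_iff] at hψ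
  constructor
  · intro h u hu
    rw [mem_unitPreimage_iff] at hu ⊢
    rw [← hψ]
    exact h ⟨_, hu, rfl⟩
  · rintro h _ ⟨a, ha, rfl⟩
    obtain ⟨u, rfl⟩ := hM ha
    rw [hψ]
    exact h u ha

/-- **`ψ(M) = M` iff `β` and `β⁻¹` map `{u : L u ∈ M}` into itself** — the lattice-moving question for print's (Ind1)
strip part at `v` IS a question about THE units transport of `φ` on `𝒪_v^×`. [cite: MochizukiAbsAnab2004, Prop 1.2.1 (iii) p.10] -/
theorem image_eq_iff_liftUnits_mapsTo (hψ : Realises v L (stripMulAut v φ) ψ) (M : AddSubgroup (v.adicCompletion F))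
    (hM : (M : Set (v.adicCompletion F)) ⊆ Set.range fun u : (↥(v.adicCompletionIntegers F))ˣ => L (Additive.ofMul u)) :
    ψ '' (M : Set (v.adicCompletion F)) = M ↔
      (∀ u ∈ unitPreimage L M, liftUnits v φ u ∈ unitPreimage L M) ∧
        ∀ u ∈ unitPreimage L M, liftUnits v φ.symm u ∈ unitPreimage L M := by
  rw [← image_subset_iff_liftUnits_mapsTo v L hψ M hM,
    ← image_subset_iff_liftUnits_mapsTo v L (realises_strip_symm v L hψ) M hM]
  constructor
  · intro h
    refine ⟨h.le, ?_⟩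
    rintro _ ⟨a, ha, rfl⟩
    have : a ∈ ψ '' (M : Set (v.adicCompletion F)) := by rw [h]; exact ha
    obtain ⟨b, hb, rfl⟩ := this
    rw [AddEquiv.symm_apply_apply]
    exact hb
  · rintro ⟨h1, h2⟩
    apply Set.Subset.antisymm h1
    intro a ha
    refine ⟨ψ.symm a, h2 ⟨a, ha, rfl⟩, ψ.apply_symm_apply a⟩

/-- In particular: **if `β` maps the unit preimage of `M` ONTO itself then `ψ(M) = M`.**
[cite: MochizukiAbsAnab2004, Prop 1.2.1 (iii) p.10] -/
theorem image_eq_of_liftUnits_map_eq (hψ : Realises v L (stripMulAut v φ) ψ) (M : AddSubgroup (v.adicCompletion F))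
    (hM : (M : Set (v.adicCompletion F)) ⊆ Set.range fun u : (↥(v.adicCompletionIntegers F))ˣ => L (Additive.ofMul u))
    (hβ : (unitPreimage L M).map (liftUnits v φ).toMonoidHom = unitPreimage L M) :
    ψ '' (M : Set (v.adicCompletion F)) = M := by
  rw [image_eq_iff_liftUnits_mapsTo v L hψ M hM]
  constructor
  · intro u hu
    rw [← hβ]
    exact Subgroup.mem_map.mpr ⟨u, hu, rfl⟩
  · intro u hu
    rw [← hβ] at hu
    obtain ⟨u', hu', rfl⟩ := Subgroup.mem_map.mp hu
    change liftUnits v φ.symm (liftUnits v φ u') ∈ _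
    rw [← liftUnits_symm_apply, MulEquiv.symm_apply_apply]
    exact hu'

end Criterion

/-! ## 3. The decided cases: inner automorphisms (and, via the sequels, local degree one / field automorphisms) -/

/-- **An INNER strip automorphism fixes EVERY sub-lattice `M ⊆ L(𝒪_v^×)`** (`liftUnits v (conj σ) = 1`).
[claim: Mochizuki2012, status: disputed] -/
theorem image_eq_of_realises_innerAut (σ : Gal v) {ψ : v.adicCompletion F ≃+ v.adicCompletion F}
    (hψ : Realises v L (stripMulAut v (innerAut v σ)) ψ) (M : AddSubgroup (v.adicCompletion F))
    (hM : (M : Set (v.adicCompletion F)) ⊆ Set.range fun u : (↥(v.adicCompletionIntegers F))ˣ => L (Additive.ofMul u)) :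
    ψ '' (M : Set (v.adicCompletion F)) = M := by
  apply image_eq_of_liftUnits_map_eq v L hψ M hM
  ext u
  simp only [Subgroup.mem_map, MulEquiv.coe_toMonoidHom, liftUnits_innerAut, exists_eq_right]

/-- The same phrased through `ψ(L(S)) = L(S)`: an inner strip automorphism fixes the log-image of EVERY set of units.
[claim: Mochizuki2012, status: disputed] -/
theorem image_log_image_eq_of_realises_innerAut (σ : Gal v) {ψ : v.adicCompletion F ≃+ v.adicCompletion F}
    (hψ : Realises v L (stripMulAut v (innerAut v σ)) ψ) (S : Set (↥(v.adicCompletionIntegers F))ˣ) :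
    ψ '' ((fun u => L (Additive.ofMul u)) '' S) = (fun u => L (Additive.ofMul u)) '' S := by
  rw [image_log_image_eq_of_realises_strip v L hψ]
  congr 1
  ext u
  simp only [Set.mem_image, liftUnits_innerAut, exists_eq_right]

end Summit.ABC.IUTFork.Thm311.Real

end
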